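import Mathlib
import Summits.ValiantsHypothesis.ValiantsHypothesis.Theorems.NewtonTauWeak.Negative.Zonogon
import Summits.ValiantsHypothesis.ValiantsHypothesis.Theorems.NewtonUnitEquationsNewtonTauWeakSeparatedRank
import Summits.ValiantsHypothesis.ValiantsHypothesis.Theorems.NewtonUnitEquationsNewtonTauWeakVdpDefs
import Summits.ValiantsHypothesis.ValiantsHypothesis.Theorems.NewtonUnitEquationsNewtonTauWeakStubVertexCharts
import Summits.ValiantsHypothesis.ValiantsHypothesis.Theorems.NewtonUnitEquationsNewtonTauWeakStubChartPairCount
import Summits.ValiantsHypothesis.ValiantsHypothesis.Theorems.NewtonUnitEquationsNewtonTauWeakStubProductVertices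

/-!
# `NewtonUnitEquationsNewtonTauWeakHexagonSeparated` — Δ-Wronskian rung, HexagonSeparated

Rung toward `stub_binomialNewtonTauCommon` (crux `NewtonTauWeak`, stmt-ValiantsHypothesis-5904), line
`binomial-normal-form`, lead c3: the GLOBAL Δ-WRONSKIAN argument for sums of three hexagon products
`A(x)·B(y)·C(xy)` (exponent lists on the three lines through `(1,0)`, `(0,1)`, `(1,1)`; any degrees).

This file: closure of the support classes and of "separated of rank R" under sums, products (registered stub `hex_sep_mul`: ranks multiply) and `Δ` (registered stub `hex_sep_delta`: rank at most doubles), and the vertex bound `vert ≤ 4R` (registered stub `hex_vert_le_of_sep` = the landed rung `vert_sum_mul_le_of_separated`, p89342).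

Conventions (spelled inline, no new definitions): `Δ` is ANY self-map of `ℂ[X,Y]` with
`coeff e (Δ p) = (e₀ - e₁) · coeff e p` (the Euler derivation `X∂_X - Y∂_Y`, which kills the diagonal
direction); "x-only" `P` means `∀ e ∈ P.support, e 1 = 0`, "y-only" `∀ e ∈ Q.support, e 0 = 0`, "diagonal"
`∀ e ∈ D.support, e 0 = e 1`; "separated of rank `R`" means `m = Σ_{r<R} P_r · Q_r` with `P_r` x-only and
`Q_r` y-only. [folklore]
-/

set_option linter.dupNamespace false

noncomputable section

namespace Summit.ValiantsHypothesis.ValiantsHypothesis.Theorems.NewtonUnitEquationsNewtonTauWeak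

open scoped BigOperators
open MvPolynomial
open Literature.Computability.AlgebraicComplexity (newtonVertexCount)
open Summit.ValiantsHypothesis.ValiantsHypothesis.Theorems.NewtonTauWeakVdp
open Summit.ValiantsHypothesis.ValiantsHypothesis.Theorems.NewtonTauWeak.Negative (vert)

namespace HexagonSeparatedAux

/-- An additively closed exponent predicate that holds on the supports of `p` and `q` holds on
the support of `p * q` (because `(p * q).support ⊆ p.support + q.support`). -/
theorem support_mul_of_add_closed (C : (Fin 2 →₀ ℕ) → Prop)
    (hC : ∀ a b, C a → C b → C (a + b)) (p q : MvPolynomial (Fin 2) ℂ)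
    (hp : ∀ e ∈ p.support, C e) (hq : ∀ e ∈ q.support, C e) :
    ∀ e ∈ (p * q).support, C e := by
  intro e he
  obtain ⟨a, ha, b, hb, rfl⟩ := Finset.mem_add.mp (support_mul p q he)
  exact hC a b (hp a ha) (hq b hb)

end HexagonSeparatedAux

/-- `hex_xonly_mul` (see file header). [folklore] -/
theorem hex_xonly_mul (P P' : MvPolynomial (Fin 2) ℂ) (hP : ∀ e ∈ P.support, e 1 = 0)
    (hP' : ∀ e ∈ P'.support, e 1 = 0) : ∀ e ∈ (P * P').support, e 1 = 0 :=
  HexagonSeparatedAux.support_mul_of_add_closed (fun e => e 1 = 0)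
    (fun a b ha hb => by simp only [Finsupp.coe_add, Pi.add_apply, ha, hb, add_zero]) P P' hP hP'

/-- `hex_yonly_mul` (see file header). [folklore] -/
theorem hex_yonly_mul (Q Q' : MvPolynomial (Fin 2) ℂ) (hQ : ∀ e ∈ Q.support, e 0 = 0)
    (hQ' : ∀ e ∈ Q'.support, e 0 = 0) : ∀ e ∈ (Q * Q').support, e 0 = 0 :=
  HexagonSeparatedAux.support_mul_of_add_closed (fun e => e 0 = 0)
    (fun a b ha hb => by simp only [Finsupp.coe_add, Pi.add_apply, ha, hb, add_zero]) Q Q' hQ hQ'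

/-- `hex_diag_mul` (see file header). [folklore] -/
theorem hex_diag_mul (D D' : MvPolynomial (Fin 2) ℂ) (hD : ∀ e ∈ D.support, e 0 = e 1)
    (hD' : ∀ e ∈ D'.support, e 0 = e 1) : ∀ e ∈ (D * D').support, e 0 = e 1 :=
  HexagonSeparatedAux.support_mul_of_add_closed (fun e => e 0 = e 1)
    (fun a b ha hb => by simp only [Finsupp.coe_add, Pi.add_apply, ha, hb]) D D' hD hD'

/-- `hex_sep_add` (see file header). [folklore] -/
theorem hex_sep_add {R S : ℕ} {m m' : MvPolynomial (Fin 2) ℂ}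
    (hm : ∃ P Q : Fin R → MvPolynomial (Fin 2) ℂ, (∀ r, ∀ e ∈ (P r).support, e 1 = 0) ∧
      (∀ r, ∀ e ∈ (Q r).support, e 0 = 0) ∧ m = ∑ r, P r * Q r)
    (hm' : ∃ P Q : Fin S → MvPolynomial (Fin 2) ℂ, (∀ r, ∀ e ∈ (P r).support, e 1 = 0) ∧
      (∀ r, ∀ e ∈ (Q r).support, e 0 = 0) ∧ m' = ∑ r, P r * Q r) :
    ∃ P Q : Fin (R + S) → MvPolynomial (Fin 2) ℂ, (∀ r, ∀ e ∈ (P r).support, e 1 = 0) ∧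
      (∀ r, ∀ e ∈ (Q r).support, e 0 = 0) ∧ m + m' = ∑ r, P r * Q r := by
  obtain ⟨P, Q, hP, hQ, rfl⟩ := hm
  obtain ⟨P', Q', hP', hQ', rfl⟩ := hm'
  refine ⟨Fin.append P P', Fin.append Q Q', fun r => ?_, fun r => ?_, ?_⟩
  · refine Fin.addCases (fun i => ?_) (fun i => ?_) r
    · rw [Fin.append_left]
      exact hP i
    · rw [Fin.append_right]
      exact hP' i
  · refine Fin.addCases (fun i => ?_) (fun i => ?_) r
    · rw [Fin.append_left]
      exact hQ i
    · rw [Fin.append_right]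
      exact hQ' i
  · rw [Fin.sum_univ_add]
    simp only [Fin.append_left, Fin.append_right]

/-- `hex_sep_neg` (see file header). [folklore] -/
theorem hex_sep_neg {R : ℕ} {m : MvPolynomial (Fin 2) ℂ}
    (hm : ∃ P Q : Fin R → MvPolynomial (Fin 2) ℂ, (∀ r, ∀ e ∈ (P r).support, e 1 = 0) ∧
      (∀ r, ∀ e ∈ (Q r).support, e 0 = 0) ∧ m = ∑ r, P r * Q r) :
    ∃ P Q : Fin R → MvPolynomial (Fin 2) ℂ, (∀ r, ∀ e ∈ (P r).support, e 1 = 0) ∧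
      (∀ r, ∀ e ∈ (Q r).support, e 0 = 0) ∧ -m = ∑ r, P r * Q r := by
  obtain ⟨P, Q, hP, hQ, rfl⟩ := hm
  refine ⟨fun r => -P r, Q, fun r => ?_, hQ, ?_⟩
  · rw [support_neg]
    exact hP r
  · rw [← Finset.sum_neg_distrib]
    exact Finset.sum_congr rfl fun r _ => (neg_mul _ _).symm

/-- `hex_sep_mul` (see file header). [folklore] -/
theorem hex_sep_mul {R S : ℕ} {m m' : MvPolynomial (Fin 2) ℂ}
    (hm : ∃ P Q : Fin R → MvPolynomial (Fin 2) ℂ, (∀ r, ∀ e ∈ (P r).support, e 1 = 0) ∧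
      (∀ r, ∀ e ∈ (Q r).support, e 0 = 0) ∧ m = ∑ r, P r * Q r)
    (hm' : ∃ P Q : Fin S → MvPolynomial (Fin 2) ℂ, (∀ r, ∀ e ∈ (P r).support, e 1 = 0) ∧
      (∀ r, ∀ e ∈ (Q r).support, e 0 = 0) ∧ m' = ∑ r, P r * Q r) :
    ∃ P Q : Fin (R * S) → MvPolynomial (Fin 2) ℂ, (∀ r, ∀ e ∈ (P r).support, e 1 = 0) ∧
      (∀ r, ∀ e ∈ (Q r).support, e 0 = 0) ∧ m * m' = ∑ r, P r * Q r := by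
  obtain ⟨P, Q, hP, hQ, rfl⟩ := hm
  obtain ⟨P', Q', hP', hQ', rfl⟩ := hm'
  refine ⟨fun k => P (finProdFinEquiv.symm k).1 * P' (finProdFinEquiv.symm k).2,
    fun k => Q (finProdFinEquiv.symm k).1 * Q' (finProdFinEquiv.symm k).2,
    fun k => hex_xonly_mul _ _ (hP _) (hP' _), fun k => hex_yonly_mul _ _ (hQ _) (hQ' _), ?_⟩
  symm
  calc ∑ k : Fin (R * S), P (finProdFinEquiv.symm k).1 * P' (finProdFinEquiv.symm k).2 *
          (Q (finProdFinEquiv.symm k).1 * Q' (finProdFinEquiv.symm k).2)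
      = ∑ x : Fin R × Fin S, P x.1 * Q x.1 * (P' x.2 * Q' x.2) :=
        Fintype.sum_equiv finProdFinEquiv.symm _ _ fun k => by ring
    _ = ∑ r, ∑ s, P r * Q r * (P' s * Q' s) := Fintype.sum_prod_type _
    _ = (∑ r, P r * Q r) * ∑ s, P' s * Q' s := (Fintype.sum_mul_sum _ _).symm

/-- `Δ` (coefficient law + Leibniz as hypotheses) maps `Sep R` into `Sep (2R)`. -/
theorem hex_sep_delta (Δ : MvPolynomial (Fin 2) ℂ → MvPolynomial (Fin 2) ℂ)
    (hΔ : ∀ p e, coeff e (Δ p) = (((e 0 : ℕ) : ℂ) - ((e 1 : ℕ) : ℂ)) * coeff e p)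
    (hL : ∀ p q, Δ (p * q) = Δ p * q + p * Δ q)
    {R : ℕ} {m : MvPolynomial (Fin 2) ℂ}
    (hm : ∃ P Q : Fin R → MvPolynomial (Fin 2) ℂ, (∀ r, ∀ e ∈ (P r).support, e 1 = 0) ∧
      (∀ r, ∀ e ∈ (Q r).support, e 0 = 0) ∧ m = ∑ r, P r * Q r) :
    ∃ P Q : Fin (2 * R) → MvPolynomial (Fin 2) ℂ, (∀ r, ∀ e ∈ (P r).support, e 1 = 0) ∧
      (∀ r, ∀ e ∈ (Q r).support, e 0 = 0) ∧ Δ m = ∑ r, P r * Q r := by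
  obtain ⟨P, Q, hP, hQ, rfl⟩ := hm
  -- `Δ` does not enlarge supports, and is additive over finite sums (coefficient law).
  have hsub : ∀ p, (Δ p).support ⊆ p.support := fun p e he => by
    rw [mem_support_iff] at he ⊢
    rw [hΔ] at he
    exact right_ne_zero_of_mul he
  have hsum : Δ (∑ r, P r * Q r) = ∑ r, Δ (P r * Q r) := by
    refine MvPolynomial.ext _ _ fun e => ?_
    rw [hΔ, coeff_sum, coeff_sum, Finset.mul_sum]
    exact Finset.sum_congr rfl fun r _ => (hΔ _ _).symm
  -- Leibniz splits each summand in two: rank `R + R`, reindexed along `2 * R = R + R`.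
  obtain ⟨P', Q', hP', hQ', h⟩ := hex_sep_add (R := R) (S := R)
    (m := ∑ r, Δ (P r) * Q r) (m' := ∑ r, P r * Δ (Q r))
    ⟨fun r => Δ (P r), Q, fun r e he => hP r e (hsub _ he), hQ, rfl⟩
    ⟨P, fun r => Δ (Q r), hP, fun r e he => hQ r e (hsub _ he), rfl⟩
  refine ⟨fun k => P' (k.cast (two_mul R)), fun k => Q' (k.cast (two_mul R)), fun k => hP' _,
    fun k => hQ' _, ?_⟩
  rw [hsum, Fin.sum_congr' (fun j => P' j * Q' j) (two_mul R), ← h, ← Finset.sum_add_distrib]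
  exact Finset.sum_congr rfl fun r _ => hL _ _

/-- = `vert_sum_mul_le_of_separated` repackaged. -/
theorem hex_vert_le_of_sep {R : ℕ} {m : MvPolynomial (Fin 2) ℂ}
    (hm : ∃ P Q : Fin R → MvPolynomial (Fin 2) ℂ, (∀ r, ∀ e ∈ (P r).support, e 1 = 0) ∧
      (∀ r, ∀ e ∈ (Q r).support, e 0 = 0) ∧ m = ∑ r, P r * Q r) :
    vert m ≤ 4 * R := by
  obtain ⟨P, Q, hP, hQ, rfl⟩ := hm
  exact vert_sum_mul_le_of_separated R P Q hP hQ


end Summit.ValiantsHypothesis.ValiantsHypothesis.Theorems.NewtonUnitEquationsNewtonTauWeak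

end
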